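import Summits.BirchSwinnertonDyer.BirchSwinnertonDyer.Theorems.TwoAdicConverseFullTwoTorsionNeitherSemistable
import Literature.NumberTheory.EllipticCurves.Greenberg1999.TwoTorsionDiscriminantConfigurationProofs
import HarnessLib

/-!
# Route `TwoAdicConverse` (rung S3), stratum (β): the THREE pairs through a curve with FULL rational `2`-torsion have
# types (R₂, R₁, R₂), (M₂, M₁, R₂) or (M₂, R₁, M₂) — according as the ramified point is the least, the middle or the
# largest one (proofs only)

Cell `bsd-2adic` (run/shared/lean/pub/bsd-2adic/), seat `bsd-2adic-conv-1` (GEN 20).  THEOREMS ONLY — no definition, no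
named fact, no `sorry`; `--supports stmt-BirchSwinnertonDyer-19218`.  HONEST FRAMING: structure theorems about Greenberg's
configurations (LNM 1716 §5); nothing about `μ`, `λ` or BSD is claimed; nothing is booked.  PARTITION (D-0054): none — RANK
axis (S3), stratum (β) at a good-ordinary OR multiplicative `2`, the full-`2`-torsion classes (census N < 5·10⁵, X5 residue:
the 19 good-ordinary and 24 multiplicative full-`2`-torsion classes; N < 10⁴ all ranks: the classes with ≥ 3 pairs).

Let `W/ℚ` be globally minimal with `a₁` odd (good ordinary or multiplicative at `2`) and three rational `2`-torsion abscissae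
`x₁ < x₂ < x₃`.  Then `Δ(W) > 0` (`Δ_pos_of_two_twoTorsion`: two rational `2`-torsion points already force it), the real `2`-division roots are exactly `x₁, x₂, x₃`, so
`x₁` is «odd» (least), `x₂` is «middle», `x₃` is «co-odd» (`positions_of_fullTwoTorsion`); exactly one of them is ramified at
`2` (conv-1 GEN 5/19: `exists_twoTorsionRamifiedAtTwo_of_fullTwoTorsion_of_odd_a₁`, `not_twoTorsionRamifiedAtTwo_and`).  In the
member-level type vocabulary of `TwoTorsionPairTypeDualProofs` (R₁/M₁/R₂/M₂) the three pairs `W → W/⟨Pᵢ⟩` therefore have types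
* ramified = least   ⟹ (R₂, R₁, R₂)  (`pairTypes_of_fullTwoTorsion_of_ramified_least`),
* ramified = middle  ⟹ (M₂, M₁, R₂)  (`…_of_ramified_middle`),
* ramified = largest ⟹ (M₂, R₁, M₂)  (`…_of_ramified_largest`),
and in every case the pair through `x₁` is of atom-A₃ type and some pair is PURE (`exists_typeA₃_and_pure_of_fullTwoTorsion`):
a full-`2`-torsion class is never «A₃-free» (so the twist-stable atoms-only classes A₁-only / A₂-only consist of single
pairs) and always contains a Prop-5.13 curve (GEN 19's `exists_partner_ramified_and_odd_of_fullTwoTorsion…`, recovered).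
Census (conv-1 GEN 20, N < 10⁴ all ranks, 24 356 points): the class signatures {R₁,R₂}, {M₁,M₂,R₂}, {M₂,R₁} and their unions
are exactly the ones that occur beside the four single types — as these theorems predict.

References: R. Greenberg, LNM 1716 (1999), §5 Props. 5.13–5.14 and Remarks pp. 120–124 [GreenbergLNM1716]; J. H. Silverman,
*AEC*, III.2.3, III.4.5, VII.2.2 [SilvermanAEC2009].
-/

set_option linter.dupNamespace false  -- `BirchSwinnertonDyer.BirchSwinnertonDyer` is the sub's path (D-0017)
set_option autoImplicit false

noncomputable section

open scoped Classical
open WeierstrassCurve Literature Literature.NumberTheory.EllipticCurves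
  Literature.NumberTheory.EllipticCurves.Rank1Residual
  Literature.NumberTheory.EllipticCurves.Greenberg1999
  Summit.BirchSwinnertonDyer.BirchSwinnertonDyer.Theorems.TwoAdicTwistConverse

namespace Summit.BirchSwinnertonDyer.BirchSwinnertonDyer.Theorems.TwoAdicOffHabitat

variable (W : WeierstrassCurve ℚ) [W.IsElliptic]

section Positions

variable {x₁ x₂ x₃ : ℚ}

omit [W.IsElliptic] in
/-- With three rational `2`-torsion abscissae, every real root of the `2`-division cubic is one of them
(`4X³ + b₂X² + 2b₄X + b₆ = 4(X − x₁)(X − x₂)(X − x₃)`). [cite: SilvermanAEC2009, III.2.3 (b) (ψ₂)] -/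
theorem real_roots_of_fullTwoTorsion (h12 : x₁ < x₂) (h23 : x₂ < x₃) (h₁ : HasRationalTwoTorsionX W x₁)
    (h₂ : HasRationalTwoTorsionX W x₂) (h₃ : HasRationalTwoTorsionX W x₃) :
    ∀ r : ℝ, 4 * r ^ 3 + (W.b₂ : ℝ) * r ^ 2 + 2 * (W.b₄ : ℝ) * r + (W.b₆ : ℝ) = 0 →
      r = x₁ ∨ r = x₂ ∨ r = x₃ := by
  obtain ⟨y₁, hP₁, ht₁⟩ := h₁
  obtain ⟨y₂, hP₂, ht₂⟩ := h₂
  obtain ⟨y₃, hP₃, ht₃⟩ := h₃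
  have c₁ := fourXCubed_add_eq_zero_of_twoTorsion_real hP₁ ht₁
  have c₂ := fourXCubed_add_eq_zero_of_twoTorsion_real hP₂ ht₂
  have c₃ := fourXCubed_add_eq_zero_of_twoTorsion_real hP₃ ht₃
  have h12' : (x₁ : ℝ) ≠ x₂ := fun h => h12.ne (by exact_mod_cast h)
  have h13' : (x₁ : ℝ) ≠ x₃ := fun h => (h12.trans h23).ne (by exact_mod_cast h)
  have h23' : (x₂ : ℝ) ≠ x₃ := fun h => h23.ne (by exact_mod_cast h)
  intro r hr
  rw [fourXCubed_eq_prod_of_three_roots c₁ c₂ c₃ h12' h13' h23' r] at hr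
  rcases mul_eq_zero.mp hr with h | h
  · rcases mul_eq_zero.mp h with h' | h'
    · rcases mul_eq_zero.mp h' with h'' | h''
      · norm_num at h''
      · exact Or.inl (sub_eq_zero.mp h'')
    · exact Or.inr (Or.inl (sub_eq_zero.mp h'))
  · exact Or.inr (Or.inr (sub_eq_zero.mp h))

/-- **Two distinct rational points of order `2` ⟹ `Δ > 0`** (with `Δ < 0` a rational `2`-torsion abscissa is the ONLY real
root of the `2`-division cubic); in particular full rational `2`-torsion forces `Δ > 0`.
[cite: GreenbergLNM1716, §5 Remark (chunk p0170)] -/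
theorem Δ_pos_of_two_twoTorsion (h12 : x₁ ≠ x₂) (h₁ : HasRationalTwoTorsionX W x₁) (h₂ : HasRationalTwoTorsionX W x₂) :
    0 < W.Δ := by
  have hΔ0 : W.Δ ≠ 0 := by rw [← W.coe_Δ']; exact W.Δ'.ne_zero
  rcases lt_trichotomy W.Δ 0 with hl | he | hg
  · exfalso
    obtain ⟨y₁, hP₁, ht₁⟩ := h₁
    obtain ⟨y₂, hP₂, ht₂⟩ := h₂
    set C : VariableChange ℚ := ⟨1, x₁, -W.a₁ / 2, y₁⟩ with hC
    have hns : W.toAffine.Nonsingular x₁ y₁ := (WeierstrassCurve.Affine.equation_iff_nonsingular).mp hP₁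
    have hy : y₁ = W.toAffine.negY x₁ y₁ := by
      rw [WeierstrassCurve.Affine.negY]; linear_combination ht₁
    haveI hNF : (C • W).IsTwoTorsionNF := isTwoTorsionNF_smul_of_two_nsmul_eq_zero two_ne_zero hns hy
    have huniq := eq_of_twoDivision_root_of_Δ_neg W C hl (x₂ : ℝ) (fourXCubed_add_eq_zero_of_twoTorsion_real hP₂ ht₂)
    have : x₂ = x₁ := by exact_mod_cast huniq
    exact h12 this.symm
  · exact absurd he hΔ0
  · exact hg

omit [W.IsElliptic] in
/-- **Positions**: `x₁` is odd (least) and not co-odd, `x₂` is middle, `x₃` is co-odd (largest) and not odd.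
[cite: GreenbergLNM1716, §5 Remark (chunks p0170, p0174)] -/
theorem positions_of_fullTwoTorsion (h12 : x₁ < x₂) (h23 : x₂ < x₃) (h₁ : HasRationalTwoTorsionX W x₁)
    (h₂ : HasRationalTwoTorsionX W x₂) (h₃ : HasRationalTwoTorsionX W x₃) :
    (TwoTorsionOdd W x₁ ∧ ¬ ∀ r : ℝ, 4 * r ^ 3 + (W.b₂ : ℝ) * r ^ 2 + 2 * (W.b₄ : ℝ) * r + (W.b₆ : ℝ) = 0 → r ≤ (x₁ : ℝ)) ∧
    (¬ TwoTorsionOdd W x₂ ∧ ¬ ∀ r : ℝ, 4 * r ^ 3 + (W.b₂ : ℝ) * r ^ 2 + 2 * (W.b₄ : ℝ) * r + (W.b₆ : ℝ) = 0 → r ≤ (x₂ : ℝ)) ∧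
    (¬ TwoTorsionOdd W x₃ ∧ ∀ r : ℝ, 4 * r ^ 3 + (W.b₂ : ℝ) * r ^ 2 + 2 * (W.b₄ : ℝ) * r + (W.b₆ : ℝ) = 0 → r ≤ (x₃ : ℝ)) := by
  have hroots := real_roots_of_fullTwoTorsion W h12 h23 h₁ h₂ h₃
  obtain ⟨y₁, hP₁, ht₁⟩ := h₁
  obtain ⟨y₂, hP₂, ht₂⟩ := h₂
  obtain ⟨y₃, hP₃, ht₃⟩ := h₃
  have c₁ := fourXCubed_add_eq_zero_of_twoTorsion_real hP₁ ht₁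
  have c₂ := fourXCubed_add_eq_zero_of_twoTorsion_real hP₂ ht₂
  have c₃ := fourXCubed_add_eq_zero_of_twoTorsion_real hP₃ ht₃
  have h12' : (x₁ : ℝ) < x₂ := by exact_mod_cast h12
  have h23' : (x₂ : ℝ) < x₃ := by exact_mod_cast h23
  refine ⟨⟨?_, ?_⟩, ⟨?_, ?_⟩, ⟨?_, ?_⟩⟩
  · intro r hr
    rcases hroots r hr with rfl | rfl | rfl
    · exact le_rfl
    · exact h12'.le
    · exact (h12'.trans h23').le
  · intro h; exact absurd (h x₂ c₂) (not_le.mpr h12')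
  · intro h; exact absurd (h x₁ c₁) (not_le.mpr h12')
  · intro h; exact absurd (h x₃ c₃) (not_le.mpr h23')
  · intro h; exact absurd (h x₂ c₂) (not_le.mpr h23')
  · intro r hr
    rcases hroots r hr with rfl | rfl | rfl
    · exact (h12'.trans h23').le
    · exact h23'.le
    · exact le_rfl

end Positions

section Types

variable [W.IsGloballyMinimal] {x₁ x₂ x₃ : ℚ}

/-- **Exactly one of the three points is ramified at `2`** (`a₁` odd: existence by Vieta, conv-1 GEN 19; uniqueness: at most one
ramified point on a minimal equation, conv-1 GEN 5). [cite: GreenbergLNM1716, §5 (chunk p0168) and Remark (chunk p0170)] [cite: SilvermanAEC2009, VII.2.2] -/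
theorem ramified_cases_of_fullTwoTorsion (hW : GoodOrd W 2 ∨ Mult W 2) (h12 : x₁ < x₂) (h23 : x₂ < x₃)
    (h₁ : HasRationalTwoTorsionX W x₁) (h₂ : HasRationalTwoTorsionX W x₂) (h₃ : HasRationalTwoTorsionX W x₃) :
    (TwoTorsionRamifiedAtTwo x₁ ∧ ¬ TwoTorsionRamifiedAtTwo x₂ ∧ ¬ TwoTorsionRamifiedAtTwo x₃) ∨
    (¬ TwoTorsionRamifiedAtTwo x₁ ∧ TwoTorsionRamifiedAtTwo x₂ ∧ ¬ TwoTorsionRamifiedAtTwo x₃) ∨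
    (¬ TwoTorsionRamifiedAtTwo x₁ ∧ ¬ TwoTorsionRamifiedAtTwo x₂ ∧ TwoTorsionRamifiedAtTwo x₃) := by
  have n12 : x₁ ≠ x₂ := h12.ne
  have n13 : x₁ ≠ x₃ := (h12.trans h23).ne
  have n23 : x₂ ≠ x₃ := h23.ne
  have ha₁ := odd_a₁_integralModelInt_of_goodOrd_or_mult W hW
  have u12 := not_twoTorsionRamifiedAtTwo_and W n12 n13 n23 h₁ h₂ h₃
  have u13 := not_twoTorsionRamifiedAtTwo_and W n13 n12 n23.symm h₁ h₃ h₂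
  have u23 := not_twoTorsionRamifiedAtTwo_and W n23 n12.symm n13.symm h₂ h₃ h₁
  rcases exists_twoTorsionRamifiedAtTwo_of_fullTwoTorsion_of_odd_a₁ W ha₁ n12 n13 n23 h₁ h₂ h₃ with h | h | h
  · exact Or.inl ⟨h, fun h' ↦ u12 ⟨h, h'⟩, fun h' ↦ u13 ⟨h, h'⟩⟩
  · exact Or.inr (Or.inl ⟨fun h' ↦ u12 ⟨h', h⟩, h, fun h' ↦ u23 ⟨h, h'⟩⟩)
  · exact Or.inr (Or.inr ⟨fun h' ↦ u13 ⟨h', h⟩, fun h' ↦ u23 ⟨h', h⟩, h⟩)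

omit [W.IsGloballyMinimal] in
/-- **Ramified = least ⟹ types (R₂, R₁, R₂)**: `x₁` is a Prop-5.13 point with `Δ > 0` (type R₂), `x₂` an unramified middle
point (type R₁), `x₃` an unramified co-odd «neither» point (type R₂) — the whole class is PURE.
[cite: GreenbergLNM1716, §5 Props. 5.13–5.14 and Remarks (chunks p0168–p0174)] -/
theorem pairTypes_of_fullTwoTorsion_of_ramified_least (h12 : x₁ < x₂) (h23 : x₂ < x₃)
    (h₁ : HasRationalTwoTorsionX W x₁) (h₂ : HasRationalTwoTorsionX W x₂) (h₃ : HasRationalTwoTorsionX W x₃)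
    (hR₁ : TwoTorsionRamifiedAtTwo x₁) (hR₂ : ¬ TwoTorsionRamifiedAtTwo x₂) (hR₃ : ¬ TwoTorsionRamifiedAtTwo x₃) :
    (0 < W.Δ ∧ TwoTorsionRamifiedAtTwo x₁ ∧ TwoTorsionOdd W x₁) ∧
    (¬ TwoTorsionRamifiedAtTwo x₂ ∧ ¬ TwoTorsionOdd W x₂ ∧
      ¬ ∀ r : ℝ, 4 * r ^ 3 + (W.b₂ : ℝ) * r ^ 2 + 2 * (W.b₄ : ℝ) * r + (W.b₆ : ℝ) = 0 → r ≤ (x₂ : ℝ)) ∧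
    (0 < W.Δ ∧ ¬ TwoTorsionRamifiedAtTwo x₃ ∧ ¬ TwoTorsionOdd W x₃ ∧
      ∀ r : ℝ, 4 * r ^ 3 + (W.b₂ : ℝ) * r ^ 2 + 2 * (W.b₄ : ℝ) * r + (W.b₆ : ℝ) = 0 → r ≤ (x₃ : ℝ)) := by
  have hΔ := Δ_pos_of_two_twoTorsion W h12.ne h₁ h₂
  obtain ⟨⟨ho₁, -⟩, ⟨ho₂, hc₂⟩, ⟨ho₃, hc₃⟩⟩ := positions_of_fullTwoTorsion W h12 h23 h₁ h₂ h₃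
  exact ⟨⟨hΔ, hR₁, ho₁⟩, ⟨hR₂, ho₂, hc₂⟩, ⟨hΔ, hR₃, ho₃, hc₃⟩⟩

omit [W.IsGloballyMinimal] in
/-- **Ramified = middle ⟹ types (M₂, M₁, R₂)**: `x₁` unramified-odd with `Δ > 0` (M₂), `x₂` ramified-middle (M₁, a Prop-5.14
point), `x₃` unramified co-odd «neither» (R₂). [cite: GreenbergLNM1716, §5 Props. 5.13–5.14 and Remarks (chunks p0168–p0174)] -/
theorem pairTypes_of_fullTwoTorsion_of_ramified_middle (h12 : x₁ < x₂) (h23 : x₂ < x₃)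
    (h₁ : HasRationalTwoTorsionX W x₁) (h₂ : HasRationalTwoTorsionX W x₂) (h₃ : HasRationalTwoTorsionX W x₃)
    (hR₁ : ¬ TwoTorsionRamifiedAtTwo x₁) (hR₂ : TwoTorsionRamifiedAtTwo x₂) (hR₃ : ¬ TwoTorsionRamifiedAtTwo x₃) :
    (0 < W.Δ ∧ ¬ TwoTorsionRamifiedAtTwo x₁ ∧ TwoTorsionOdd W x₁) ∧
    (TwoTorsionRamifiedAtTwo x₂ ∧ ¬ TwoTorsionOdd W x₂ ∧
      ¬ ∀ r : ℝ, 4 * r ^ 3 + (W.b₂ : ℝ) * r ^ 2 + 2 * (W.b₄ : ℝ) * r + (W.b₆ : ℝ) = 0 → r ≤ (x₂ : ℝ)) ∧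
    (0 < W.Δ ∧ ¬ TwoTorsionRamifiedAtTwo x₃ ∧ ¬ TwoTorsionOdd W x₃ ∧
      ∀ r : ℝ, 4 * r ^ 3 + (W.b₂ : ℝ) * r ^ 2 + 2 * (W.b₄ : ℝ) * r + (W.b₆ : ℝ) = 0 → r ≤ (x₃ : ℝ)) := by
  have hΔ := Δ_pos_of_two_twoTorsion W h12.ne h₁ h₂
  obtain ⟨⟨ho₁, -⟩, ⟨ho₂, hc₂⟩, ⟨ho₃, hc₃⟩⟩ := positions_of_fullTwoTorsion W h12 h23 h₁ h₂ h₃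
  exact ⟨⟨hΔ, hR₁, ho₁⟩, ⟨hR₂, ho₂, hc₂⟩, ⟨hΔ, hR₃, ho₃, hc₃⟩⟩

omit [W.IsGloballyMinimal] in
/-- **Ramified = largest ⟹ types (M₂, R₁, M₂)**: `x₁` unramified-odd with `Δ > 0` (M₂), `x₂` unramified-middle «neither»
(R₁), `x₃` ramified co-odd not odd (M₂, a Prop-5.14 point). [cite: GreenbergLNM1716, §5 Props. 5.13–5.14 and Remarks (chunks p0168–p0174)] -/
theorem pairTypes_of_fullTwoTorsion_of_ramified_largest (h12 : x₁ < x₂) (h23 : x₂ < x₃)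
    (h₁ : HasRationalTwoTorsionX W x₁) (h₂ : HasRationalTwoTorsionX W x₂) (h₃ : HasRationalTwoTorsionX W x₃)
    (hR₁ : ¬ TwoTorsionRamifiedAtTwo x₁) (hR₂ : ¬ TwoTorsionRamifiedAtTwo x₂) (hR₃ : TwoTorsionRamifiedAtTwo x₃) :
    (0 < W.Δ ∧ ¬ TwoTorsionRamifiedAtTwo x₁ ∧ TwoTorsionOdd W x₁) ∧
    (¬ TwoTorsionRamifiedAtTwo x₂ ∧ ¬ TwoTorsionOdd W x₂ ∧
      ¬ ∀ r : ℝ, 4 * r ^ 3 + (W.b₂ : ℝ) * r ^ 2 + 2 * (W.b₄ : ℝ) * r + (W.b₆ : ℝ) = 0 → r ≤ (x₂ : ℝ)) ∧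
    (0 < W.Δ ∧ TwoTorsionRamifiedAtTwo x₃ ∧ ¬ TwoTorsionOdd W x₃ ∧
      ∀ r : ℝ, 4 * r ^ 3 + (W.b₂ : ℝ) * r ^ 2 + 2 * (W.b₄ : ℝ) * r + (W.b₆ : ℝ) = 0 → r ≤ (x₃ : ℝ)) := by
  have hΔ := Δ_pos_of_two_twoTorsion W h12.ne h₁ h₂
  obtain ⟨⟨ho₁, -⟩, ⟨ho₂, hc₂⟩, ⟨ho₃, hc₃⟩⟩ := positions_of_fullTwoTorsion W h12 h23 h₁ h₂ h₃
  exact ⟨⟨hΔ, hR₁, ho₁⟩, ⟨hR₂, ho₂, hc₂⟩, ⟨hΔ, hR₃, ho₃, hc₃⟩⟩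

/-- **A full-`2`-torsion curve always lies in an atom-A₃ pair (`Δ > 0`, the odd point `x₁`) AND in a PURE pair** (type R₁ or
R₂: the ramified least point is 5.13; otherwise the unramified «neither» point `x₂` or `x₃` has a 5.13 partner) — so a class
with full rational `2`-torsion is never A₃-free and always contains a Prop-5.13 curve.
[cite: GreenbergLNM1716, §5 Props. 5.13–5.14 and Remarks (chunks p0168–p0174)] -/
theorem exists_typeA₃_and_pure_of_fullTwoTorsion (hW : GoodOrd W 2 ∨ Mult W 2) (h12 : x₁ < x₂) (h23 : x₂ < x₃)
    (h₁ : HasRationalTwoTorsionX W x₁) (h₂ : HasRationalTwoTorsionX W x₂) (h₃ : HasRationalTwoTorsionX W x₃) :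
    (∃ x : ℚ, HasRationalTwoTorsionX W x ∧ 0 < W.Δ ∧ (TwoTorsionOdd W x ∨
        ∀ r : ℝ, 4 * r ^ 3 + (W.b₂ : ℝ) * r ^ 2 + 2 * (W.b₄ : ℝ) * r + (W.b₆ : ℝ) = 0 → r ≤ (x : ℝ))) ∧
    (∃ x : ℚ, HasRationalTwoTorsionX W x ∧
      ((0 < W.Δ ∧ TwoTorsionRamifiedAtTwo x ∧ TwoTorsionOdd W x) ∨
        (¬ TwoTorsionRamifiedAtTwo x ∧ ¬ TwoTorsionOdd W x))) := by
  have hΔ := Δ_pos_of_two_twoTorsion W h12.ne h₁ h₂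
  obtain ⟨⟨ho₁, -⟩, ⟨ho₂, -⟩, ⟨ho₃, -⟩⟩ := positions_of_fullTwoTorsion W h12 h23 h₁ h₂ h₃
  refine ⟨⟨x₁, h₁, hΔ, Or.inl ho₁⟩, ?_⟩
  rcases ramified_cases_of_fullTwoTorsion W hW h12 h23 h₁ h₂ h₃ with ⟨hr₁, -, -⟩ | ⟨-, -, hr₃⟩ | ⟨-, hr₂, -⟩
  · exact ⟨x₁, h₁, Or.inl ⟨hΔ, hr₁, ho₁⟩⟩
  · exact ⟨x₃, h₃, Or.inr ⟨hr₃, ho₃⟩⟩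
  · exact ⟨x₂, h₂, Or.inr ⟨hr₂, ho₂⟩⟩

end Types

end Summit.BirchSwinnertonDyer.BirchSwinnertonDyer.Theorems.TwoAdicOffHabitat

end
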